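import Literature.NumberTheory.LFunctions.ZetaUniversalityDiscProofs
import Literature.NumberTheory.LFunctions.EulerProductDensenessProofs
import Literature.NumberTheory.LFunctions.ZetaEulerProductMeanSquareUniformProofs
import HarnessLib

/-!
# Voronin's universality theorem on discs — the main assembly

Topic `Literature/NumberTheory/LFunctions`. Everything in this file is PROVED:

* `Steuding2007_thm1_9_discAnalytic_of_facts` — Voronin's universality theorem for `ζ` on closed
  discs (`Literature.NumberTheory.LFunctions.Steuding2007_thm1_9_discAnalytic`, Steuding Thm. 1.9
  for discs) from the denseness fact `twistedEulerProduct_dense_disc` and the mean-square fact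
  `zeta_sub_finiteEulerProduct_meanSquare_uniform`, by Voronin's argument (Steuding §1.3,
  (1.22)–(1.26); Bayart–Matheron §11.7) in the first-order form of the tree's Bohr–Courant proof.
  See `ZetaUniversalityDiscProofs.lean` for the architecture and the lemmas.
* `Steuding2007_thm1_9_discAnalytic_holds` — **the discharge**: both facts are PROVED in the tree
  (`twistedEulerProduct_dense_disc_holds`, `EulerProductDensenessProofs.lean`: Bagchi's denseness
  lemma via the `ℓ²` model of the disc, Hahn–Banach, entire functions of exponential type and the
  prime number theorem with error term; `zeta_sub_finiteEulerProduct_meanSquare_uniform_holds`,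
  `ZetaEulerProductMeanSquareUniformProofs.lean`), so Voronin's theorem on discs — and with it
  Steuding's Thm. 1.7 (`voronin_disc_of_thm1_9_discAnalytic`,
  `Literature.Barriers.RiemannHypothesis.Voronin1975_universality_of_thm1_9_discAnalytic`) and
  Bagchi's Thm. 8.3 (`Steuding2007_thm8_3_of_thm1_9_discAnalytic`) — is now unconditional.

## References

* [Steuding2007] J. Steuding, *Value-Distribution of L-Functions*, LNM 1877, §1.3, Thm. 1.9.
* [BayartMatheron2009] F. Bayart, É. Matheron, *Dynamics of Linear Operators*, Ch. 11, §11.7.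
-/

noncomputable section

open Complex Filter Set Metric MeasureTheory Topology
open scoped Real

namespace Literature.NumberTheory.LFunctions

open VoroninTools VoroninTorus VoroninAssembly Literature.NumberTheory.DiophantineApproximation
open Literature.Barriers.RiemannHypothesis.BohrCourant (fourier_one_coe mem_primesBelow_of_le
  pow_le_measureReal_box measurableSet_box)

set_option maxHeartbeats 1000000 in
-- a single long assembly proof (the quantifier bookkeeping of Voronin's argument)
/-- **Voronin's universality theorem on discs from the denseness and mean-square facts**
(Steuding, Thm. 1.9 for `K` a closed disc and targets analytic on a larger disc; Voronin 1975).
[cite: Steuding2007, Thm. 1.9 and §1.3 (1.17)–(1.26)] [cite: BayartMatheron2009, §11.7] -/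
theorem Steuding2007_thm1_9_discAnalytic_of_facts (hCden : twistedEulerProduct_dense_disc)
    (hEms : zeta_sub_finiteEulerProduct_meanSquare_uniform) :
    Steuding2007_thm1_9_discAnalytic := by
  intro c ρ R hρ hρR h1 h2 g hgd hg0 ε₀ hε₀
  -- WLOG `ε ≤ 1`
  obtain ⟨ε, hε, hε1, hεε₀⟩ : ∃ ε : ℝ, 0 < ε ∧ ε ≤ 1 ∧ ε ≤ ε₀ :=
    ⟨min ε₀ 1, lt_min hε₀ one_pos, min_le_right _ _, min_le_left _ _⟩
  suffices H : ∃ δ : ℝ, 0 < δ ∧ ∃ T₀ : ℝ, ∀ T : ℝ, T₀ ≤ T → ENNReal.ofReal (δ * T) ≤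
      volume ({τ : ℝ | ∀ s ∈ closedBall c ρ, ‖riemannZeta (s + τ * I) - g s‖ < ε} ∩ Icc 0 T) by
    obtain ⟨δ, hδ, T₀, hT⟩ := H
    refine ⟨δ, hδ, T₀, fun T hTT ↦ (hT T hTT).trans (measure_mono ?_)⟩
    exact inter_subset_inter_left _ fun τ hτ s hs ↦ (hτ s hs).trans_le hεε₀
  classical
  /- Step 0: radii `ρ < ρ'` (circle, inside the strip) and `ρ < R₁` (zero-free disc). -/
  obtain ⟨R₁, hρR₁, hR₁R, hg0'⟩ :=
    exists_gt_forall_closedBall_ne_zero hρ.le hρR hgd.continuousOn hg0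
  have hgd₁ : DifferentiableOn ℂ g (ball c R₁) := hgd.mono (ball_subset_ball hR₁R.le)
  have hg0₁ : ∀ s ∈ ball c R₁, g s ≠ 0 := fun s hs ↦ hg0' s (ball_subset_closedBall hs)
  obtain ⟨ρ', hρρ', hσ₁, hσ₂⟩ : ∃ ρ' : ℝ, ρ < ρ' ∧ 1 / 2 < c.re - ρ' ∧ c.re + ρ' < 1 := by
    refine ⟨ρ + min (c.re - ρ - 1 / 2) (1 - c.re - ρ) / 2, ?_, ?_, ?_⟩
    · have : 0 < min (c.re - ρ - 1 / 2) (1 - c.re - ρ) := lt_min (by linarith) (by linarith)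
      linarith
    · have := min_le_left (c.re - ρ - 1 / 2) (1 - c.re - ρ); linarith
    · have := min_le_right (c.re - ρ - 1 / 2) (1 - c.re - ρ); linarith
  have hρ'0 : 0 < ρ' := hρ.trans hρρ'
  obtain ⟨σ₁, hσ₁def⟩ : ∃ σ₁ : ℝ, σ₁ = c.re - ρ' := ⟨_, rfl⟩
  obtain ⟨σ₂, hσ₂def⟩ : ∃ σ₂ : ℝ, σ₂ = c.re + ρ' := ⟨_, rfl⟩
  obtain ⟨A, hAdef⟩ : ∃ A : ℝ, A = |c.im| + ρ' := ⟨_, rfl⟩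
  have hσ₁half : 1 / 2 < σ₁ := by rw [hσ₁def]; exact hσ₁
  have hσ₁σ₂ : σ₁ ≤ σ₂ := by rw [hσ₁def, hσ₂def]; linarith
  have hσ₂one : σ₂ < 1 := by rw [hσ₂def]; exact hσ₂
  have hA0 : 0 ≤ A := by rw [hAdef]; positivity
  -- the circle points
  have hcm_mem : ∀ α : ℝ, circleMap c ρ' α ∈ closedBall c ρ' := fun α ↦
    sphere_subset_closedBall (circleMap_mem_sphere c hρ'0.le α)
  have hcm_re : ∀ α : ℝ, σ₁ ≤ (circleMap c ρ' α).re ∧ (circleMap c ρ' α).re ≤ σ₂ := by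
    intro α
    obtain ⟨ha, hb⟩ := abs_le.1 (abs_re_sub_re_le_of_mem_closedBall (hcm_mem α))
    rw [hσ₁def, hσ₂def]
    exact ⟨by linarith, by linarith⟩
  have hcm_im : ∀ α : ℝ, |(circleMap c ρ' α).im| ≤ A := by
    intro α
    have hz1 : ‖circleMap c ρ' α - c‖ ≤ ρ' := by
      have := hcm_mem α; rwa [mem_closedBall, dist_eq_norm] at this
    have hz2 : |(circleMap c ρ' α - c).im| ≤ ‖circleMap c ρ' α - c‖ := Complex.abs_im_le_norm _
    rw [sub_im] at hz2
    rw [hAdef]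
    have h3 := abs_sub_abs_le_abs_sub (circleMap c ρ' α).im c.im
    linarith [hz2.trans hz1]
  -- Cauchy constant
  obtain ⟨Cc, hCcdef⟩ : ∃ Cc : ℝ, Cc = ρ' ^ 2 / (2 * π * (ρ' - ρ) ^ 2) := ⟨_, rfl⟩
  have hCc0 : 0 < Cc := by
    rw [hCcdef]; have := sub_pos.2 hρρ'; positivity
  -- a bound for `g` on the disc
  obtain ⟨Mg, hMg⟩ : ∃ Mg : ℝ, ∀ s ∈ closedBall c ρ, ‖g s‖ ≤ Mg :=
    (isCompact_closedBall c ρ).exists_bound_of_continuousOn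
      (hgd.continuousOn.mono (closedBall_subset_ball hρR))
  have hMg0 : 0 ≤ Mg := (norm_nonneg _).trans (hMg c (mem_closedBall_self hρ.le))
  -- `δ₁` with `(Mg + 1)(4δ₁) = ε/4`
  obtain ⟨δ₁, hδ₁0, hδ₁s, hKδ⟩ : ∃ δ₁ : ℝ, 0 < δ₁ ∧ δ₁ ≤ 1 / 32 ∧ (Mg + 1) * (4 * δ₁) ≤ ε / 4 := by
    refine ⟨ε / (32 * (Mg + 1)), by positivity, ?_, ?_⟩
    · rw [div_le_div_iff₀ (by positivity) (by norm_num)]; nlinarith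
    · have e7 : (Mg + 1) * (4 * (ε / (32 * (Mg + 1)))) = ε / 8 := by field_simp; ring
      rw [e7]; linarith
  -- thresholds `d` (tail sum on the circle) and `e` (`ζ - ζ_P` on the circle)
  obtain ⟨d, hddef⟩ : ∃ d : ℝ, d = δ₁ ^ 2 / Cc := ⟨_, rfl⟩
  obtain ⟨e, hedef⟩ : ∃ e : ℝ, e = (ε / 4) ^ 2 / Cc := ⟨_, rfl⟩
  have hd0 : 0 < d := by rw [hddef]; positivity
  have he0 : 0 < e := by rw [hedef]; positivity
  have hCcd : Cc * d = δ₁ ^ 2 := by rw [hddef]; field_simp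
  have hCce : Cc * e = (ε / 4) ^ 2 := by rw [hedef]; field_simp
  -- the tail level `d/(8π)` is below `δ₁`
  have htail_le : d / (8 * π) ≤ δ₁ := by
    rw [hddef, hCcdef, div_div, div_le_iff₀ (by have := sub_pos.2 hρρ'; positivity)]
    have h1' : (ρ' - ρ) ^ 2 ≤ ρ' ^ 2 := by nlinarith
    have h2' : δ₁ ^ 2 ≤ δ₁ := by nlinarith
    calc δ₁ ^ 2 = δ₁ ^ 2 * 1 := by ring
      _ ≤ δ₁ * (ρ' ^ 2 / (2 * π * (ρ' - ρ) ^ 2) * (8 * π)) := by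
          have hq : 1 ≤ ρ' ^ 2 / (2 * π * (ρ' - ρ) ^ 2) * (8 * π) := by
            rw [div_mul_eq_mul_div, le_div_iff₀ (by have := sub_pos.2 hρρ'; positivity)]
            nlinarith [Real.pi_pos]
          nlinarith
  /- Step 1: the cut-off `N₁` from the tail `Σ_{k≥N} k^{-2σ₁}`. -/
  obtain ⟨N₁, hN₁4, hN₁tail⟩ : ∃ N₁ : ℕ, 4 ≤ N₁ ∧ ∀ N : ℕ, N₁ ≤ N →
      ∑' k : ℕ, ((k + N : ℕ) : ℝ) ^ (-(2 * σ₁)) < d / (8 * π) := by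
    obtain ⟨N₁, hN₁⟩ := eventually_atTop.1
      (((EulerProductMeanSquare.tendsto_tsum_rpow_tail (σ := σ₁)).eventually_lt_const
        (show (0 : ℝ) < d / (8 * π) by positivity)).and (eventually_ge_atTop 4))
    exact ⟨N₁, (hN₁ N₁ le_rfl).2, fun N hN ↦ (hN₁ N hN).1⟩
  /- Step 2: steering (the denseness fact). -/
  obtain ⟨N, hN₁N, ϑ, hsteer⟩ := hCden c ρ R₁ hρ hρR₁ h1 h2 g hgd₁ hg0₁ (ε / 8) (by positivity) N₁
  have hN4 : 4 ≤ N := hN₁4.trans hN₁N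
  have htailN : ∑' k : ℕ, ((k + N : ℕ) : ℝ) ^ (-(2 * σ₁)) < d / (8 * π) := hN₁tail N hN₁N
  clear hN₁tail hN₁4 hN₁N N₁
  /- Step 3: a continuity radius `r` on the fixed torus `(ℝ/ℤ)^{primes<N}`, uniform in `s`. -/
  obtain ⟨Zf, hZf⟩ : ∃ Zf : ℂ × UnitAddTorus ↥(N.primesBelow) → ℂ, Zf = fun p ↦
      ∏ q : ↥(N.primesBelow), (1 - (q.1 : ℂ) ^ (-p.1) * fourier 1 (p.2 q))⁻¹ := ⟨_, rfl⟩
  obtain ⟨θ₀, hθ₀⟩ : ∃ θ₀ : UnitAddTorus ↥(N.primesBelow), θ₀ = fun q ↦ ((ϑ q.1 : ℝ) : UnitAddCircle) :=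
    ⟨_, rfl⟩
  have hre_disc : ∀ s ∈ closedBall c ρ, 1 / 2 < s.re := by
    intro s hs
    obtain ⟨ha, -⟩ := abs_le.1 (abs_re_sub_re_le_of_mem_closedBall hs)
    linarith
  have hZfc : ContinuousOn Zf (closedBall c ρ ×ˢ univ) := by
    rw [hZf]
    refine continuousOn_finsetProd _ fun q _ ↦ ?_
    have hq : (q.1 : ℂ) ≠ 0 := by exact_mod_cast (Nat.prime_of_mem_primesBelow q.2).ne_zero
    have hq2 : 2 ≤ q.1 := (Nat.prime_of_mem_primesBelow q.2).two_le
    have hc1 : Continuous fun p : ℂ × UnitAddTorus ↥(N.primesBelow) ↦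
        (1 : ℂ) - (q.1 : ℂ) ^ (-p.1) * fourier 1 (p.2 q) :=
      continuous_const.sub ((Continuous.const_cpow continuous_fst.neg (Or.inl hq)).mul
        ((fourier 1).continuous.comp ((continuous_apply q).comp continuous_snd)))
    refine hc1.continuousOn.inv₀ fun p hp ↦ ?_
    exact one_sub_cpow_mul_fourier_ne_zero hq2 (by linarith [hre_disc p.1 hp.1]) _
  have hZf₀ : ∀ s ∈ closedBall c ρ, ‖Zf (s, θ₀) - g s‖ < ε / 8 := by
    intro s hs
    have e1 : Zf (s, θ₀) = ∏ p ∈ N.primesBelow,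
        (1 - (p : ℂ) ^ (-s) * cexp (2 * Real.pi * I * ϑ p))⁻¹ := by
      rw [hZf, hθ₀, ← Finset.prod_coe_sort (N.primesBelow)]
      refine Finset.prod_congr rfl fun p _ ↦ ?_
      simp only [fourier_one_coe]
    rw [e1, norm_sub_rev]
    exact hsteer s hs
  obtain ⟨r, hr0, hr1, hbox⟩ : ∃ r : ℝ, 0 < r ∧ r ≤ 1 ∧ ∀ θ : UnitAddTorus ↥(N.primesBelow),
      (∀ q, dist (θ q) (θ₀ q) < r) → ∀ s ∈ closedBall c ρ, ‖Zf (s, θ) - g s‖ < ε / 4 := by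
    obtain ⟨r', hr'0, hr'⟩ := exists_radius_forall_norm_sub_lt (isCompact_closedBall c ρ) hZfc
      (show (0 : ℝ) < ε / 8 by positivity) θ₀
    refine ⟨min r' 1, lt_min hr'0 one_pos, min_le_right _ _, fun θ hθ s hs ↦ ?_⟩
    have hd : dist θ θ₀ < r' :=
      lt_of_lt_of_le ((dist_pi_lt_iff (lt_min hr'0 one_pos)).2 hθ) (min_le_left _ _)
    have h1' := hr' θ hd s hs
    have h2' := hZf₀ s hs
    calc ‖Zf (s, θ) - g s‖ = ‖(Zf (s, θ) - Zf (s, θ₀)) + (Zf (s, θ₀) - g s)‖ := by ring_nf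
      _ ≤ ‖Zf (s, θ) - Zf (s, θ₀)‖ + ‖Zf (s, θ₀) - g s‖ := norm_add_le _ _
      _ < ε / 8 + ε / 8 := add_lt_add h1' h2'
      _ = ε / 4 := by ring
  clear hsteer hZf₀ hZfc
  /- Step 4: the box size `rb` and the constant `c₁`. -/
  obtain ⟨rb, hrbdef⟩ : ∃ rb : ℝ, rb = r / (4 * N) := ⟨_, rfl⟩
  have hN0 : (0 : ℝ) < N := by exact_mod_cast (show 0 < N by omega)
  have hrb0 : 0 < rb := by rw [hrbdef]; positivity
  have hrb1 : rb ≤ 1 := by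
    rw [hrbdef, div_le_one (by positivity)]
    have : (4 : ℝ) ≤ N := by exact_mod_cast hN4
    linarith
  obtain ⟨c₁, hc₁def⟩ : ∃ c₁ : ℝ, c₁ = rb ^ N / 2 := ⟨_, rfl⟩
  have hc₁0 : 0 < c₁ := by rw [hc₁def]; positivity
  /- Step 5: the mean-square fact on the circle. -/
  obtain ⟨εE, hεEdef⟩ : ∃ εE : ℝ, εE = e * c₁ / (8 * π) := ⟨_, rfl⟩
  have hεE0 : 0 < εE := by rw [hεEdef]; positivity
  obtain ⟨P₀, hP₀⟩ := hEms σ₁ σ₂ A εE hσ₁half hσ₁σ₂ hσ₂one hA0 hεE0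
  obtain ⟨P, hNP, hP₀P⟩ : ∃ P : ℕ, N ≤ P ∧ P₀ ≤ P := ⟨max N P₀, le_max_left _ _, le_max_right _ _⟩
  obtain ⟨T₀, hT₀⟩ := hP₀ P hP₀P
  clear hP₀ hP₀P P₀
  /- Step 6: the torus `(ℝ/ℤ)^{primes<P}`, its flow and the functions on it. -/
  obtain ⟨l, hl⟩ : ∃ l : ↥(P.primesBelow) → ℝ, l = fun q ↦ -Real.log q.1 / (2 * Real.pi) :=
    ⟨_, rfl⟩
  have hlin : LinearIndependent ℤ l := by
    rw [hl]
    exact KroneckerWeyl.linearIndependent_neg_log_prime_div _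
      fun p hp ↦ Nat.prime_of_mem_primesBelow hp
  obtain ⟨ext, hext⟩ : ∃ ext : UnitAddTorus ↥(P.primesBelow) → ℕ → UnitAddCircle,
      ext = fun θ n ↦ if h : n ∈ P.primesBelow then θ ⟨n, h⟩ else 0 := ⟨_, rfl⟩
  obtain ⟨res, hres⟩ : ∃ res : UnitAddTorus ↥(P.primesBelow) → UnitAddTorus ↥(N.primesBelow),
      res = fun θ q ↦ θ ⟨q.1, mem_primesBelow_of_le hNP q.2⟩ := ⟨_, rfl⟩
  have hresc : Continuous res := by
    rw [hres]; exact continuous_pi fun q ↦ continuous_apply _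
  obtain ⟨Zt, hZt⟩ : ∃ Zt : ℂ → UnitAddTorus ↥(P.primesBelow) → ℂ, Zt = fun s θ ↦
      ∏ n ∈ N.primesBelow, (1 - (n : ℂ) ^ (-s) * fourier 1 (ext θ n))⁻¹ := ⟨_, rfl⟩
  obtain ⟨S, hS⟩ : ∃ S : Finset ↥(P.primesBelow), S = Finset.univ.filter (fun q ↦ N ≤ q.1) :=
    ⟨_, rfl⟩
  obtain ⟨Lt, hLt⟩ : ∃ Lt : ℂ → UnitAddTorus ↥(P.primesBelow) → ℂ, Lt = fun s θ ↦
      ∑ q ∈ S, (q.1 : ℂ) ^ (-s) * fourier 1 (θ q) := ⟨_, rfl⟩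
  obtain ⟨Qt, hQt⟩ : ∃ Qt : ℂ → UnitAddTorus ↥(P.primesBelow) → ℂ, Qt = fun s θ ↦
      ∏ q ∈ S, (1 - (q.1 : ℂ) ^ (-s) * fourier 1 (θ q))⁻¹ := ⟨_, rfl⟩
  obtain ⟨Dt, hDt⟩ : ∃ Dt : UnitAddTorus ↥(P.primesBelow) → ℝ, Dt = fun θ ↦
      ∑ q : ↥(N.primesBelow), dist (res θ q) (θ₀ q) := ⟨_, rfl⟩
  obtain ⟨φt, hφt⟩ : ∃ φt : UnitAddTorus ↥(P.primesBelow) → ℝ, φt = fun θ ↦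
      max 0 (1 - 2 / r * Dt θ) := ⟨_, rfl⟩
  obtain ⟨Mt, hMt⟩ : ∃ Mt : UnitAddTorus ↥(P.primesBelow) → ℝ, Mt = fun θ ↦
      ∫ α in (0 : ℝ)..2 * π, ‖Lt (circleMap c ρ' α) θ‖ ^ 2 := ⟨_, rfl⟩
  -- the steering product on the big torus is the fixed-torus product of the restriction
  have hZtf : ∀ (s : ℂ) (θ : UnitAddTorus ↥(P.primesBelow)), Zt s θ = Zf (s, res θ) := by
    intro s θ
    rw [hZt, hZf, hres]
    dsimp only
    rw [← Finset.prod_coe_sort (N.primesBelow)]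
    refine Finset.prod_congr rfl fun q _ ↦ ?_
    rw [hext]
    simp only [dif_pos (mem_primesBelow_of_le hNP q.2)]
  -- continuity
  have hDtc : Continuous Dt := by
    rw [hDt]
    exact continuous_finsetSum _ fun q _ ↦
      ((continuous_apply q).comp hresc).dist continuous_const
  have hφc : Continuous φt := by
    rw [hφt]; exact continuous_const.max (continuous_const.sub (continuous_const.mul hDtc))
  have hMtc : Continuous Mt := by
    rw [hMt, hLt]; exact continuous_circleMeanSquare_firstOrderSum S c ρ'
  have hψc : Continuous fun θ ↦ φt θ * Mt θ := hφc.mul hMtc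
  -- values of `φ`
  have hDt0 : ∀ θ, 0 ≤ Dt θ := fun θ ↦ by rw [hDt]; exact Finset.sum_nonneg fun q _ ↦ dist_nonneg
  have hφ01 : ∀ θ, 0 ≤ φt θ ∧ φt θ ≤ 1 := by
    intro θ
    rw [hφt]
    refine ⟨le_max_left _ _, max_le zero_le_one ?_⟩
    have : 0 ≤ 2 / r * Dt θ := mul_nonneg (by positivity) (hDt0 θ)
    linarith
  have hφpos : ∀ θ, 0 < φt θ → ∀ q, dist (res θ q) (θ₀ q) < r := by
    intro θ h q
    rw [hφt] at h
    rcases lt_max_iff.1 h with h | h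
    · exact absurd h (lt_irrefl 0)
    · have hD : Dt θ < r / 2 := by
        rw [sub_pos] at h
        have h' : 2 / r * Dt θ < 1 := h
        rw [div_mul_eq_mul_div, div_lt_one hr0] at h'
        linarith
      have hle : dist (res θ q) (θ₀ q) ≤ Dt θ := by
        rw [hDt]
        exact Finset.single_le_sum (f := fun q ↦ dist (res θ q) (θ₀ q))
          (fun q _ ↦ dist_nonneg) (Finset.mem_univ q)
      linarith
  have hφhalf : ∀ θ, Dt θ ≤ r / 8 → 1 / 2 ≤ φt θ := by
    intro θ h
    rw [hφt]
    refine le_trans ?_ (le_max_right _ _)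
    have : 2 / r * Dt θ ≤ 2 / r * (r / 8) := mul_le_mul_of_nonneg_left h (by positivity)
    have e2 : 2 / r * (r / 8) = 1 / 4 := by field_simp; ring
    linarith
  -- invariance of `φ` under translation of the coordinates `q ≥ N`
  have hφinv : ∀ j ∈ S, ∀ (θ : UnitAddTorus ↥(P.primesBelow)) (a : UnitAddCircle),
      φt (θ + Pi.single j a) = φt θ := by
    intro j hj θ a
    have hj' : N ≤ j.1 := by rw [hS] at hj; exact (Finset.mem_filter.1 hj).2
    have e1 : res (θ + Pi.single j a) = res θ := by
      rw [hres]
      funext q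
      have hne : (⟨q.1, mem_primesBelow_of_le hNP q.2⟩ : ↥(P.primesBelow)) ≠ j := by
        intro h
        have h2' : q.1 = j.1 := congrArg Subtype.val h
        have := Nat.lt_of_mem_primesBelow q.2
        omega
      simp only [Pi.add_apply, Pi.single_eq_of_ne hne, add_zero]
    rw [hφt, hDt]
    beta_reduce
    rw [e1]
  -- the box where `φ ≥ 1/2`
  have hφbox : ∀ θ : UnitAddTorus ↥(P.primesBelow),
      θ ∈ Set.pi Set.univ (fun q : ↥(P.primesBelow) ↦ if q.1 < N then
        Metric.closedBall (((ϑ q.1 : ℝ) : UnitAddCircle)) (rb / 2) else Set.univ) →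
      1 / 2 ≤ φt θ := by
    intro θ hθ
    refine hφhalf θ ?_
    rw [Set.mem_pi] at hθ
    have hle : ∀ q : ↥(N.primesBelow), dist (res θ q) (θ₀ q) ≤ rb / 2 := by
      intro q
      have hq : q.1 < N := Nat.lt_of_mem_primesBelow q.2
      have h1' := hθ ⟨q.1, mem_primesBelow_of_le hNP q.2⟩ (Set.mem_univ _)
      simp only [hq, if_true, Metric.mem_closedBall] at h1'
      rw [hres, hθ₀]
      exact h1'
    calc Dt θ = ∑ q : ↥(N.primesBelow), dist (res θ q) (θ₀ q) := by rw [hDt]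
      _ ≤ ∑ _q : ↥(N.primesBelow), rb / 2 := Finset.sum_le_sum fun q _ ↦ hle q
      _ = (Fintype.card ↥(N.primesBelow)) * (rb / 2) := by
          rw [Finset.sum_const, nsmul_eq_mul, Finset.card_univ]
      _ ≤ N * (rb / 2) := by
          refine mul_le_mul_of_nonneg_right ?_ (by positivity)
          have : Fintype.card ↥(N.primesBelow) ≤ N := by
            rw [Fintype.card_coe]
            calc (N.primesBelow).card ≤ (Finset.range N).card :=
                  Finset.card_le_card (Finset.filter_subset _ _)
              _ = N := Finset.card_range N
          exact_mod_cast this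
      _ = r / 8 := by rw [hrbdef]; field_simp; ring
  -- the lower bound `c₁ ≤ ∫ φ`
  have hI₁ : c₁ ≤ ∫ θ, φt θ := by
    have hmeas := measurableSet_box (fun q : ↥(P.primesBelow) ↦ q.1 < N)
      (fun q ↦ ((ϑ q.1 : ℝ) : UnitAddCircle)) rb
    have hcard : (Finset.univ.filter fun q : ↥(P.primesBelow) ↦ q.1 < N).card ≤ N := by
      calc (Finset.univ.filter fun q : ↥(P.primesBelow) ↦ q.1 < N).card
          ≤ (Finset.range N).card := Finset.card_le_card_of_injOn (fun q ↦ q.1)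
              (fun q hq ↦ Finset.mem_coe.2 (Finset.mem_range.2 (Finset.mem_filter.1 hq).2))
              (fun q₁ _ q₂ _ h ↦ Subtype.ext h)
        _ = N := Finset.card_range N
    have hvol := pow_le_measureReal_box (fun q : ↥(P.primesBelow) ↦ q.1 < N)
      (fun q ↦ ((ϑ q.1 : ℝ) : UnitAddCircle)) hrb0 hrb1 hcard
    have hind : ∫ θ : UnitAddTorus ↥(P.primesBelow), Set.indicator (Set.pi Set.univ
        (fun q : ↥(P.primesBelow) ↦ if q.1 < N then
          Metric.closedBall (((ϑ q.1 : ℝ) : UnitAddCircle)) (rb / 2) else Set.univ))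
        (fun _ ↦ (1 / 2 : ℝ)) θ ≤ ∫ θ, φt θ := by
      have hfin := KroneckerWeyl.isProbabilityMeasure_volume_unitAddTorus (ι := ↥(P.primesBelow))
      refine integral_mono ((integrable_const (1 / 2 : ℝ)).indicator hmeas)
        (KroneckerWeyl.integrable_of_continuous hφc) fun θ ↦ ?_
      by_cases hθ : θ ∈ Set.pi Set.univ (fun q : ↥(P.primesBelow) ↦ if q.1 < N then
          Metric.closedBall (((ϑ q.1 : ℝ) : UnitAddCircle)) (rb / 2) else Set.univ)
      · simp only [Set.indicator_of_mem hθ]; exact hφbox θ hθ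
      · simp only [Set.indicator_of_notMem hθ]; exact (hφ01 θ).1
    rw [integral_indicator_const _ hmeas, smul_eq_mul, measureReal_def] at hind
    rw [hc₁def]
    linarith
  -- the torus average of `φ · (circle mean square of L)` is small
  have hsumsq_le : ∑ q ∈ S, ((q.1 : ℝ) ^ (-σ₁)) ^ 2 < d / (8 * π) := by
    have h := sum_sq_rpow_le_tail (P := P) (N := N) hσ₁half (s := (σ₁ : ℂ)) (by simp)
    simp only [ofReal_re] at h
    rw [hS]
    exact h.trans_lt htailN
  obtain ⟨sS, hsSdef⟩ : ∃ sS : ℝ, sS = 2 * π * ∑ q ∈ S, ((q.1 : ℝ) ^ (-σ₁)) ^ 2 := ⟨_, rfl⟩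
  have hsS0 : 0 ≤ sS := by rw [hsSdef]; positivity
  have hsSd : sS ≤ d / 4 := by
    rw [hsSdef]
    have := mul_lt_mul_of_pos_left hsumsq_le (show (0 : ℝ) < 2 * π by positivity)
    have e2 : 2 * π * (d / (8 * π)) = d / 4 := by field_simp; ring
    linarith
  have hI₂ : ∫ θ, φt θ * Mt θ ≤ sS * ∫ θ, φt θ := by
    rw [hMt, hLt, hsSdef]
    exact integral_mul_circleMeanSquare_le S hφc hφinv (fun θ ↦ (hφ01 θ).1) c ρ'
      (fun α ↦ (hcm_re α).1)
  /- Step 7: Kronecker–Weyl for `φ` and `φ · M`, and the choice of `T₁`. -/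
  set Φc : C(UnitAddTorus ↥(P.primesBelow), ℝ) := ⟨φt, hφc⟩ with hΦc
  set Ψc : C(UnitAddTorus ↥(P.primesBelow), ℝ) := ⟨fun θ ↦ φt θ * Mt θ, hψc⟩ with hΨc
  have hA₁ := KroneckerWeyl.tendsto_avg_integral_comp_flow_real hlin Φc
  have hA₂ := KroneckerWeyl.tendsto_avg_integral_comp_flow_real hlin Ψc
  have hΦcoe : ∀ θ, Φc θ = φt θ := fun θ ↦ rfl
  have hΨcoe : ∀ θ, Ψc θ = φt θ * Mt θ := fun θ ↦ rfl
  have e1 : ∀ᶠ T : ℝ in atTop, (∫ θ, φt θ) - c₁ / 16 <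
      T⁻¹ * ∫ t in (0 : ℝ)..T, Φc (fun i ↦ ((t * l i : ℝ) : UnitAddCircle)) :=
    hA₁.eventually_const_lt (by show (∫ θ, φt θ) - c₁ / 16 < ∫ θ, φt θ; linarith)
  have e2 : ∀ᶠ T : ℝ in atTop, T⁻¹ * ∫ t in (0 : ℝ)..T, Ψc (fun i ↦ ((t * l i : ℝ) : UnitAddCircle)) <
      sS * (∫ θ, φt θ) + d * c₁ / 16 :=
    hA₂.eventually_lt_const (by
      have : (0 : ℝ) < d * c₁ / 16 := by positivity
      calc ∫ θ, Ψc θ = ∫ θ, φt θ * Mt θ := rfl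
        _ ≤ sS * ∫ θ, φt θ := hI₂
        _ < _ := by linarith)
  have e4 : ∀ᶠ T : ℝ in atTop, max T₀ 1 ≤ T := eventually_ge_atTop _
  obtain ⟨T₁, hT₁⟩ := eventually_atTop.1 (e1.and (e2.and e4))
  clear e1 e2 e4 hA₁ hA₂
  refine ⟨c₁ / 4, by positivity, T₁, fun T hT ↦ ?_⟩
  obtain ⟨h1T, h2T, h4T⟩ := hT₁ T hT
  have hTT₀ : T₀ ≤ T := (le_max_left _ _).trans h4T
  have hT1 : 1 ≤ T := (le_max_right _ _).trans h4T
  have hT0 : 0 < T := by linarith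
  /- Step 8: the time integrals. -/
  have hflow : Continuous fun t : ℝ ↦ (fun q ↦ ((t * l q : ℝ) : UnitAddCircle) :
      UnitAddTorus ↥(P.primesBelow)) := KroneckerWeyl.continuous_flow l
  obtain ⟨Φ, hΦ⟩ : ∃ Φ : ℝ → ℝ, Φ = fun t : ℝ ↦ φt (fun q ↦ ((t * l q : ℝ) : UnitAddCircle)) :=
    ⟨_, rfl⟩
  obtain ⟨Λ, hΛ⟩ : ∃ Λ : ℝ → ℝ, Λ = fun t : ℝ ↦ Mt (fun q ↦ ((t * l q : ℝ) : UnitAddCircle)) :=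
    ⟨_, rfl⟩
  obtain ⟨Ef, hEf⟩ : ∃ Ef : ℝ → ℝ → ℝ, Ef = fun (t : ℝ) (α : ℝ) ↦
      ‖riemannZeta (circleMap c ρ' α + (t : ℂ) * I) -
        ∏ p ∈ P.primesBelow, (1 - (p : ℂ) ^ (-(circleMap c ρ' α + (t : ℂ) * I)))⁻¹‖ ^ 2 :=
    ⟨_, rfl⟩
  obtain ⟨E, hE⟩ : ∃ E : ℝ → ℝ, E = fun t ↦ ∫ α in (0 : ℝ)..2 * π, Ef t α := ⟨_, rfl⟩
  have hΦcont : Continuous Φ := by rw [hΦ]; exact hφc.comp hflow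
  have hΛcont : Continuous Λ := by rw [hΛ]; exact hMtc.comp hflow
  have hEfc : Continuous (Function.uncurry Ef) := by
    rw [hEf]; exact continuous_zeta_sub_eulerProduct_circle hρ'0.le hσ₁ hσ₂ P
  have hEcont : Continuous E := by
    rw [hE]; exact intervalIntegral.continuous_parametric_intervalIntegral_of_continuous' hEfc _ _
  have hΦ01 : ∀ t, 0 ≤ Φ t ∧ Φ t ≤ 1 := fun t ↦ by rw [hΦ]; exact hφ01 _
  have hΛ0 : ∀ t, 0 ≤ Λ t := by
    intro t; rw [hΛ, hMt]
    exact intervalIntegral.integral_nonneg (by positivity) fun α _ ↦ by positivity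
  have hEf0 : ∀ t α, 0 ≤ Ef t α := fun t α ↦ by rw [hEf]; positivity
  have hE0 : ∀ t, 0 ≤ E t := by
    intro t; rw [hE]
    exact intervalIntegral.integral_nonneg (by positivity) fun α _ ↦ hEf0 t α
  -- `J₁ = T A₁`
  have hJ₁ : ∫ t in (0 : ℝ)..T, Φ t =
      T * (T⁻¹ * ∫ t in (0 : ℝ)..T, Φc (fun i ↦ ((t * l i : ℝ) : UnitAddCircle))) := by
    rw [← mul_assoc, mul_inv_cancel₀ hT0.ne', one_mul, hΦ]
    rfl
  -- `J₂ = T A₂`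
  have hJ₂ : ∫ t in (0 : ℝ)..T, Φ t * Λ t ≤
      T * (T⁻¹ * ∫ t in (0 : ℝ)..T, Ψc (fun i ↦ ((t * l i : ℝ) : UnitAddCircle))) := by
    rw [← mul_assoc, mul_inv_cancel₀ hT0.ne', one_mul]
    have e : (fun t : ℝ ↦ Ψc (fun i ↦ ((t * l i : ℝ) : UnitAddCircle))) = fun t ↦ Φ t * Λ t := by
      funext t; rw [hΨcoe, hΦ, hΛ]
    rw [e]
  -- `J₃ ≤ (e c₁/4) T`
  have hJ₃ : ∫ t in (0 : ℝ)..T, Φ t * E t ≤ e * c₁ / 4 * T := by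
    have hEb : ∫ t in (0 : ℝ)..T, E t ≤ 2 * π * εE * T := by
      rw [hE]
      refine integral_circleMeanSquare_le hEfc hT0.le fun α _ ↦ ?_
      -- the mean-square fact at the circle point `circleMap c ρ' α = σ_α + i a_α`
      have h := hT₀ T hTT₀ (circleMap c ρ' α).re (hcm_re α).1 (hcm_re α).2 (circleMap c ρ' α).im
        (hcm_im α)
      have e3 : ∀ t : ℝ, ((circleMap c ρ' α).re : ℂ) + (t + (circleMap c ρ' α).im) * I =
          circleMap c ρ' α + t * I := by
        intro t
        conv_rhs => rw [← re_add_im (circleMap c ρ' α)]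
        ring
      simp only [e3] at h
      rw [hEf]
      exact h
    have hle : ∫ t in (0 : ℝ)..T, Φ t * E t ≤ ∫ t in (0 : ℝ)..T, E t :=
      intervalIntegral.integral_mono_on hT0.le ((hΦcont.mul hEcont).intervalIntegrable _ _)
        (hEcont.intervalIntegrable _ _) fun t _ ↦ mul_le_of_le_one_left (hE0 t) (hΦ01 t).2
    have e5 : 2 * π * εE * T = e * c₁ / 4 * T := by rw [hεEdef]; field_simp; ring
    linarith
  -- the test integrand `gt = Φ (1 - Λ/d - E/e)`
  obtain ⟨gt, hgt⟩ : ∃ gt : ℝ → ℝ, gt = fun t ↦ Φ t * (1 - Λ t / d - E t / e) := ⟨_, rfl⟩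
  have hgtc : Continuous gt := by
    rw [hgt]
    exact hΦcont.mul ((continuous_const.sub (hΛcont.div_const _)).sub (hEcont.div_const _))
  have hgt1 : ∀ t, gt t ≤ 1 := by
    intro t
    rw [hgt]
    have h1' : 1 - Λ t / d - E t / e ≤ 1 := by
      have := div_nonneg (hΛ0 t) hd0.le
      have := div_nonneg (hE0 t) he0.le
      linarith
    calc Φ t * (1 - Λ t / d - E t / e) ≤ Φ t * 1 :=
          mul_le_mul_of_nonneg_left h1' (hΦ01 t).1
      _ ≤ 1 := by rw [mul_one]; exact (hΦ01 t).2
  have hg_int : ∫ t in (0 : ℝ)..T, gt t =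
      (∫ t in (0 : ℝ)..T, Φ t) - (∫ t in (0 : ℝ)..T, Φ t * Λ t) / d -
        (∫ t in (0 : ℝ)..T, Φ t * E t) / e := by
    have hi1 : IntervalIntegrable Φ volume 0 T := hΦcont.intervalIntegrable _ _
    have hi2 : IntervalIntegrable (fun t ↦ Φ t * Λ t / d) volume 0 T :=
      ((hΦcont.mul hΛcont).div_const _).intervalIntegrable _ _
    have hi3 : IntervalIntegrable (fun t ↦ Φ t * E t / e) volume 0 T :=
      ((hΦcont.mul hEcont).div_const _).intervalIntegrable _ _
    have e6 : gt = fun t ↦ Φ t - Φ t * Λ t / d - Φ t * E t / e := by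
      rw [hgt]; funext t; ring
    rw [e6, intervalIntegral.integral_sub (hi1.sub hi2) hi3, intervalIntegral.integral_sub hi1 hi2,
      intervalIntegral.integral_div, intervalIntegral.integral_div]
  have hlow : c₁ / 4 * T ≤ ∫ t in (0 : ℝ)..T, gt t := by
    rw [hg_int]
    exact integral_bookkeeping hT0 hc₁0 hI₁ hd0 hsSd he0 h1T h2T hJ₁ hJ₂ hJ₃
  /- Step 9: good shifts. -/
  refine (ENNReal.ofReal_le_ofReal hlow).trans (ofReal_integral_le_volume hgtc hgt1 hT0.le ?_)
  intro t _ hgpos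
  -- unpack `gt t > 0`
  have hΦt : 0 < Φ t ∧ 0 < 1 - Λ t / d - E t / e := by
    rw [hgt] at hgpos
    rcases pos_and_pos_or_neg_and_neg_of_mul_pos hgpos with h | h
    · exact h
    · exact absurd h.1 (not_lt.2 (hΦ01 t).1)
  have hΛt : Λ t < d := by
    have h0 : 0 ≤ E t / e := div_nonneg (hE0 t) he0.le
    have : Λ t / d < 1 := by linarith [hΦt.2]
    rwa [div_lt_one hd0] at this
  have hEt : E t < e := by
    have h0 : 0 ≤ Λ t / d := div_nonneg (hΛ0 t) hd0.le
    have : E t / e < 1 := by linarith [hΦt.2]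
    rwa [div_lt_one he0] at this
  -- the torus point `θt = flow t`
  set θt : UnitAddTorus ↥(P.primesBelow) := fun q ↦ ((t * l q : ℝ) : UnitAddCircle) with hθt
  refine norm_zeta_sub_lt_of_good (P := P) hN4 h1 θt t (Z := fun s ↦ Zt s θt) hε1 hδ₁s hKδ hMg
    ?_ ?_ ?_ ?_ ?_
  · -- `Z(s, θt)` is `ε/4`-close to `g`
    intro s hs
    rw [hZtf]
    exact hbox (res θt) (hφpos θt (by have := hΦt.1; rwa [hΦ] at this)) s hs
  · -- `|L(s, θt)| < δ₁` from `Λ t < d` and Cauchy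
    intro s hs
    have hC := norm_sq_firstOrderSum_le S hρ.le hρρ' θt hs
    have hΛ' : ∫ α in (0 : ℝ)..2 * π, ‖∑ q ∈ S, (q.1 : ℂ) ^ (-circleMap c ρ' α) * fourier 1 (θt q)‖ ^ 2
        = Λ t := by rw [hΛ, hMt, hLt]
    rw [hΛ', ← hCcdef] at hC
    have hlt : ‖∑ q ∈ S, (q.1 : ℂ) ^ (-s) * fourier 1 (θt q)‖ ^ 2 < δ₁ ^ 2 := by
      calc _ ≤ Cc * Λ t := hC
        _ < Cc * d := mul_lt_mul_of_pos_left hΛt hCc0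
        _ = δ₁ ^ 2 := hCcd
    rw [hS] at hlt
    exact lt_of_pow_lt_pow_left₀ 2 hδ₁0.le hlt
  · -- the tail `Σ q^{-2 Re s} ≤ δ₁`
    intro s hs
    have hsre : σ₁ ≤ s.re := by
      obtain ⟨ha, -⟩ := abs_le.1 (abs_re_sub_re_le_of_mem_closedBall hs)
      rw [hσ₁def]; linarith
    exact ((sum_sq_rpow_le_tail (P := P) (N := N) hσ₁half hsre).trans htailN.le).trans htail_le
  · -- the Euler product along the flow
    intro s
    rw [hZt, hθt, hl]
    exact eulerProduct_eq_steering_mul_tail hNP s ext hext t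
  · -- `|ζ - ζ_P| < ε/4` from `E t < e` and Cauchy
    intro s hs
    have hC := norm_sq_zeta_sub_eulerProduct_le hρ.le hρρ' hσ₁ hσ₂ P t hs
    have hE' : ∫ α in (0 : ℝ)..2 * π, ‖riemannZeta (circleMap c ρ' α + t * I) -
        ∏ p ∈ P.primesBelow, (1 - (p : ℂ) ^ (-(circleMap c ρ' α + t * I)))⁻¹‖ ^ 2 = E t := by
      rw [hE, hEf]
    rw [hE', ← hCcdef] at hC
    have hlt : ‖riemannZeta (s + t * I) -
        ∏ p ∈ P.primesBelow, (1 - (p : ℂ) ^ (-(s + t * I)))⁻¹‖ ^ 2 < (ε / 4) ^ 2 := by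
      calc _ ≤ Cc * E t := hC
        _ < Cc * e := mul_lt_mul_of_pos_left hEt hCc0
        _ = (ε / 4) ^ 2 := hCce
    exact lt_of_pow_lt_pow_left₀ 2 (by positivity) hlt

/-- **Voronin's universality theorem on discs (Steuding, Thm. 1.9 for closed discs and targets
analytic on a larger disc) — PROVED**: the discharge of the named fact
`Literature.NumberTheory.LFunctions.Steuding2007_thm1_9_discAnalytic`, from the assembly
`Steuding2007_thm1_9_discAnalytic_of_facts` and the two discharged inputs
`twistedEulerProduct_dense_disc_holds` (denseness of twisted finite Euler products) and
`zeta_sub_finiteEulerProduct_meanSquare_uniform_holds` (mean-square approximation).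
[cite: Steuding2007, Thm. 1.9 and §1.3 (1.17)–(1.26)] [cite: BayartMatheron2009, Ch. 11] -/
theorem Steuding2007_thm1_9_discAnalytic_holds : Steuding2007_thm1_9_discAnalytic :=
  Steuding2007_thm1_9_discAnalytic_of_facts twistedEulerProduct_dense_disc_holds
    zeta_sub_finiteEulerProduct_meanSquare_uniform_holds

end Literature.NumberTheory.LFunctions
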